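/-
Copyright (c) 2026 the pub-hodgecm-mathlib formalisation cell (harness21).  Prover seat hodgecm-mathlib-K2E5-p16 (g5): Track B «K2-LIT»,
hLiu418 = stmt-HodgeConjecture-24832, ROAD Φ organ (SD-2) (arch integrals of twisted Gaussians = `ξ` in the `g`-binder), file (7c):
growth of `xiShift (g₀ + t•Ξ) h α β` in `h`, UNIFORM on the disc `‖t‖ ≤ r`, and the Cauchy estimate for its `t`-derivatives; 2026-09-04.
-/
import Summits.HodgeConjecture.HodgeConjecture.Theorems.K2LiuHermTwoEtaShiftDominatedGrowth  -- (7c-eta): dominated growth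
import Summits.HodgeConjecture.HodgeConjecture.Theorems.K2LiuHermTwoXiShiftParamHolomorphy   -- ★ (7b): radius, holomorphy in `t`
import Summits.HodgeConjecture.HodgeConjecture.Theorems.K2LiuHermTwoXiShiftGrowth         -- ★ p858778: prefactor continuity
import Mathlib.Analysis.Complex.Liouville
import HarnessLib

/-!
# Crux `HLiu418`, ROAD Φ, organ (SD-2) — file (7c): three-factor growth of `xiShift (g₀ + t•Ξ) h α β` uniform on the disc; Cauchy estimate

Cell `hodgecm-mathlib`, crux item hLiu418 = `stmt-HodgeConjecture-24832`, route of record `HCCMUnconditional`; squad K2, LEAD F0P6-plan (g13)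
(M-157i′, deal (SD-2)), co-dealer K2E5-plan (g6) («(b) growth UNIFORM on the disc by domination at `g₀∕2`; (c) `iteratedDeriv d … 0` by
ONE-variable Cauchy»), prover K2E5-p16 (g5).  THEOREMS ONLY; lane `--supports stmt-HodgeConjecture-24832 --as helper`.

WHAT.  For `g₀ = hermTwo d > 0`, a direction `Ξ`, and the domination certificate of ★ (7b) `exists_differentiableOn_xiShift_param` on `‖t‖ ≤ r`:
* `norm_xiShift_param_le₂` — for compact `K ⊂ ℂ`, `L ⊂ {0 < re β}` there are `C, N, N′ ≥ 0` with, for EVERY `‖t‖ ≤ r`, `h > 0`, `α ∈ K`, `β ∈ L`: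
  `‖xiShift (g₀ + t•Ξ) h α β‖ ≤ C · e^{−π Re tr(h g₀)} · (1 + tr h)^N · (1 + det(h)^{−N′})`  (the three-factor shape; the exponent at `g₀∕2`
  of the old `e^{−2π Re tr(hg)}` — the factor-2 loss of the domination);
* `norm_iteratedDeriv_xiShift_param_le₂` — with the same `C, N, N′` and `0 < ρ < r`, for every `d : ℕ`:
  `‖iteratedDeriv d (fun t => xiShift (g₀ + t•Ξ) h α β) 0‖ ≤ d! · ρ^{−d} · C · e^{−π Re tr(h g₀)} (1 + tr h)^N (1 + det(h)^{−N′})`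
  (★ Mathlib `Complex.norm_iteratedDeriv_le_of_forall_mem_sphere_norm_le` on the disc of ★ (7b)).
HONEST LABEL.  Count-neutral helper of the K2_Liu road; it pays no socket by itself: `HC_CM` is proved only modulo the 7 printed citations
(2 remaining named inputs: hLiu418 = `stmt-HodgeConjecture-24832`, h413 = `stmt-HodgeConjecture-24833`) until rung 0 closes.
-/

set_option autoImplicit false
-- the mandated namespace repeats the single-problem summit's segment (`HodgeConjecture.HodgeConjecture`)
set_option linter.dupNamespace false

noncomputable section

open Complex MeasureTheory Set
open scoped ComplexOrder ComplexConjugate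

namespace Summit.HodgeConjecture.HodgeConjecture.Cruxes.HLiu418.K2LiuHermTwoXiShiftParamGrowth

open Summit.HodgeConjecture.HodgeConjecture.Cruxes.HLiu418.K2LiuHermTwoGammaDefs
open Summit.HodgeConjecture.HodgeConjecture.Cruxes.HLiu418.K2LiuHermTwoEtaDefs
open Summit.HodgeConjecture.HodgeConjecture.Cruxes.HLiu418.K2LiuHermTwoEtaConvergence
open Summit.HodgeConjecture.HodgeConjecture.Cruxes.HLiu418.K2LiuHermTwoEtaHolomorphy
open Summit.HodgeConjecture.HodgeConjecture.Cruxes.HLiu418.K2LiuHermTwoXiEtaIdentity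
open Summit.HodgeConjecture.HodgeConjecture.Cruxes.HLiu418.K2LiuHermTwoEtaShiftDefs
open Summit.HodgeConjecture.HodgeConjecture.Cruxes.HLiu418.K2LiuHermTwoXiShiftGrowth
open Summit.HodgeConjecture.HodgeConjecture.Cruxes.HLiu418.K2LiuHermTwoEtaShiftDominated
open Summit.HodgeConjecture.HodgeConjecture.Cruxes.HLiu418.K2LiuHermTwoEtaShiftDominatedGrowth
open Summit.HodgeConjecture.HodgeConjecture.Cruxes.HLiu418.K2LiuHermTwoXiShiftParamHolomorphy

/-- **GROWTH OF `xiShift (g₀ + t•Ξ) h α β` IN `h`, UNIFORMLY ON THE DISC AND ON COMPACTS OF `ℂ × {re β > 0}`**: see the module docstring. -/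
theorem norm_xiShift_param_le₂ {d : ℝ × ℂ × ℝ} (hd : 0 < d.1 ∧ normSq d.2.1 < d.1 * d.2.2) (Ξ : Matrix (Fin 2) (Fin 2) ℂ) {r : ℝ} (hr : 0 ≤ r)
    (hcert : ∀ t : ℂ, ‖t‖ ≤ r → ∀ c : ℝ × ℂ × ℝ, (0 < c.1 ∧ normSq c.2.1 < c.1 * c.2.2) →
      ‖cexp (-(hermTwo c * (hermTwo ((2 : ℝ) • d) + t • ((2 : ℂ) • Ξ))).trace)‖ ≤ ‖cexp (-(hermTwo c * hermTwo ((1 / 2 : ℝ) • ((2 : ℝ) • d))).trace)‖)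
    {K L : Set ℂ} (hK : IsCompact K) (hL : IsCompact L) (hL0 : ∀ β ∈ L, 0 < β.re) :
    ∃ C N N' : ℝ, 0 ≤ C ∧ 0 ≤ N ∧ 0 ≤ N' ∧ ∀ t : ℂ, ‖t‖ ≤ r → ∀ h : Matrix (Fin 2) (Fin 2) ℂ, h.PosDef → ∀ α ∈ K, ∀ β ∈ L,
      ‖xiShift (hermTwo d + t • Ξ) h α β‖ ≤
        C * Real.exp (-(Real.pi * ((h * hermTwo d).trace).re)) * (1 + ((h 0 0).re + (h 1 1).re)) ^ N *
          (1 + ((h 0 0).re * (h 1 1).re - normSq (h 0 1)) ^ (-N')) := by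
  -- the boxes: `|re α| ≤ R`, `|α − 2| ≤ R + 2` on `K`; `b₁ ≤ re β ≤ b₂` on `L` with `b₁ > 0`
  obtain ⟨R₀, hR₀⟩ := hK.isBounded.subset_closedBall 0
  set R : ℝ := |R₀| with hR
  have hstrip : ∀ α ∈ K, -R ≤ α.re ∧ α.re ≤ R := fun α hα =>
    abs_le.mp (((Complex.abs_re_le_norm α).trans (mem_closedBall_zero_iff.mp (hR₀ hα))).trans (le_abs_self R₀))
  have hM : ∀ α ∈ K, ‖α - 2‖ ≤ R + 2 := fun α hα =>
    (norm_sub_le _ _).trans (add_le_add (((mem_closedBall_zero_iff.mp (hR₀ hα))).trans (le_abs_self R₀)) (by simp))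
  rcases L.eq_empty_or_nonempty with hLe | hLne
  · refine ⟨0, 0, 0, le_rfl, le_rfl, le_rfl, fun t _ h _ α _ β hβ => ?_⟩
    rw [hLe] at hβ
    exact absurd hβ (Set.notMem_empty β)
  obtain ⟨βm, hβm, hβmin⟩ := (hL.image Complex.continuous_re).exists_isLeast (hLne.image _)
  obtain ⟨βM, hβM, hβmax⟩ := (hL.image Complex.continuous_re).exists_isGreatest (hLne.image _)
  have hbox : ∀ β ∈ L, βm ≤ β.re ∧ β.re ≤ βM := fun β hβ =>
    ⟨hβmin (Set.mem_image_of_mem _ hβ), hβmax (Set.mem_image_of_mem _ hβ)⟩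
  have hb₁0 : 0 < βm := by
    obtain ⟨β₁, hβ₁L, hβ₁eq⟩ := hβm
    rw [← hβ₁eq]
    exact hL0 β₁ hβ₁L
  have hb12 : βm ≤ βM := by
    obtain ⟨β₁, hβ₁L, hβ₁eq⟩ := hβm
    rw [← hβ₁eq]
    exact (hbox β₁ hβ₁L).2
  -- the prefactor is bounded on `K × L`
  obtain ⟨M, hMb⟩ := (hK.prod hL).exists_bound_of_continuousOn continuous_xiShiftPrefactor₂.continuousOn
  -- the growth of the dominated `etaShift` at `(2(g₀ + tΞ), πh)`, dominating matrix `g₁ = g₀ = hermTwo d`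
  have hg : (hermTwo d).PosDef := (posDef_hermTwo_iff d).mpr hd
  have hhalf : hermTwo ((1 / 2 : ℝ) • ((2 : ℝ) • d)) = hermTwo d := by rw [smul_smul]; norm_num
  have hR2 : 0 ≤ R + 2 := by positivity
  set M₀ : ℝ := 2 * ‖(d.1 : ℂ)‖ + r * ‖((2 : ℂ) • Ξ) 0 0‖ with hM₀
  have hM₀0 : 0 ≤ M₀ := by positivity
  obtain ⟨C, hC, hB⟩ := norm_etaShift_le₂_of_dominated hg (a₁ := -R) (a₂ := R) (by linarith [abs_nonneg R₀]) hb₁0 hb12 hR2 hM₀0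
  set N : ℝ := 2 * max (R - 2) 0 + 1 with hN
  set N' : ℝ := max (2 - -R) 0 + 1 with hN'
  have hN0 : 0 ≤ N := by positivity
  have hN'0 : 0 ≤ N' := by positivity
  refine ⟨max M 0 * (C * Real.pi ^ N), N, N', by positivity, hN0, hN'0, fun t ht h hh α hα β hβ => ?_⟩
  obtain ⟨e, rfl⟩ : ∃ e : ℝ × ℂ × ℝ, hermTwo e = h := ⟨_, hermTwo_eq_of_isHermitian hh.1⟩
  have heh := (posDef_hermTwo_iff e).mp hh
  have he1 : 0 < e.1 := heh.1
  have he2 : 0 < e.2.2 := snd_pos_of_cone heh.1 heh.2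
  have hδ : 0 < e.1 * e.2.2 - normSq e.2.1 := by linarith [heh.2]
  have hπe : (hermTwo (Real.pi • e)).PosDef := posDef_hermTwo_smul Real.pi_pos hh
  -- domination of `G = 2(g₀ + tΞ)` by `g₀` on the domain of `η(·, πh)`
  have hdom : ∀ c ∈ etaTwoSet (hermTwo (Real.pi • e)),
      ‖cexp (-(hermTwo c * (hermTwo ((2 : ℝ) • d) + t • ((2 : ℂ) • Ξ))).trace)‖ ≤ ‖cexp (-(hermTwo c * hermTwo d).trace)‖ := by
    intro c hc
    obtain ⟨-, hcm⟩ := (mem_etaTwoSet_iff _ c).mp hc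
    have hx : (hermTwo c).PosDef := by
      have := hcm.add_posSemidef hπe.posSemidef
      rwa [sub_add_cancel] at this
    have h := hcert t ht c ((posDef_hermTwo_iff c).mp hx)
    rwa [hhalf] at h
  have hG00 : ‖(hermTwo ((2 : ℝ) • d) + t • ((2 : ℂ) • Ξ)) 0 0‖ ≤ M₀ := by
    rw [hM₀]
    have h1 : (hermTwo ((2 : ℝ) • d) + t • ((2 : ℂ) • Ξ)) 0 0 = 2 * (d.1 : ℂ) + t * ((2 : ℂ) • Ξ) 0 0 := by
      simp [Matrix.add_apply, Matrix.smul_apply, hermTwo]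
    rw [h1]
    refine (norm_add_le _ _).trans (add_le_add ?_ ?_)
    · rw [norm_mul]; norm_num
    · rw [norm_mul]; exact mul_le_mul_of_nonneg_right ht (norm_nonneg _)
  have hη := hB _ (hermTwo (Real.pi • e)) hπe hdom hG00 α β (hstrip α hα).1 (hstrip α hα).2 (hbox β hβ).1 (hbox β hβ).2 (hM α hα)
  simp only [hermTwo_apply_zero_zero, hermTwo_apply_one_one, hermTwo_apply_zero_one, Prod.smul_fst, Prod.smul_snd, smul_eq_mul,
    Complex.real_smul, ofReal_re, trace_hermTwo_mul_hermTwo, map_mul, normSq_ofReal] at hη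
  simp only [hermTwo_apply_zero_zero, hermTwo_apply_one_one, hermTwo_apply_zero_one, ofReal_re, trace_hermTwo_mul_hermTwo]
  rw [xiShift_def, two_smul_param, ← hermTwo_smul, norm_mul]
  have hT : Real.pi * e.1 * d.1 + Real.pi * e.2.2 * d.2.2 + 2 * ((Real.pi : ℂ) * e.2.1 * conj d.2.1).re =
      Real.pi * (e.1 * d.1 + e.2.2 * d.2.2 + 2 * (e.2.1 * conj d.2.1).re) := by
    simp only [Complex.mul_re, Complex.mul_im, Complex.ofReal_re, Complex.ofReal_im]
    ring
  have hdet : Real.pi * e.1 * (Real.pi * e.2.2) - Real.pi * Real.pi * normSq e.2.1 = Real.pi ^ 2 * (e.1 * e.2.2 - normSq e.2.1) := by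
    ring
  rw [hT, hdet] at hη
  have hπ3 := Real.pi_gt_three
  have htr : (1 + (Real.pi * e.1 + Real.pi * e.2.2)) ^ N ≤ Real.pi ^ N * (1 + (e.1 + e.2.2)) ^ N := by
    rw [← Real.mul_rpow Real.pi_pos.le (by linarith [heh.1])]
    exact Real.rpow_le_rpow (by nlinarith [heh.1]) (by nlinarith [heh.1]) hN0
  have hdt : 1 + (Real.pi ^ 2 * (e.1 * e.2.2 - normSq e.2.1)) ^ (-N') ≤ 1 + (e.1 * e.2.2 - normSq e.2.1) ^ (-N') := by
    rw [Real.mul_rpow (by positivity) hδ.le]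
    have h1 : (Real.pi ^ 2) ^ (-N') ≤ 1 := Real.rpow_le_one_of_one_le_of_nonpos (by nlinarith) (by linarith)
    nlinarith [Real.rpow_nonneg hδ.le (-N')]
  have hP : 0 ≤ Real.pi ^ N * (1 + (e.1 + e.2.2)) ^ N := by positivity
  have hQ : 0 ≤ 1 + (Real.pi ^ 2 * (e.1 * e.2.2 - normSq e.2.1)) ^ (-N') := by
    linarith [Real.rpow_nonneg (show (0 : ℝ) ≤ Real.pi ^ 2 * (e.1 * e.2.2 - normSq e.2.1) by positivity) (-N')]
  have hη' := hη.trans (mul_le_mul_of_nonneg_left (mul_le_mul htr hdt hQ hP)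
    (mul_nonneg hC (Real.exp_pos (-(Real.pi * (e.1 * d.1 + e.2.2 * d.2.2 + 2 * (e.2.1 * conj d.2.1).re)))).le))
  have hpre : ‖((4 * Real.pi ^ 4 : ℝ) : ℂ) * cexp ((Real.pi * I) * (β - α)) * (hermTwoGamma α)⁻¹ * ((Real.pi : ℂ) * Complex.Gamma β ^ 2)⁻¹‖ ≤
      max M 0 :=
    (hMb (α, β) (Set.mk_mem_prod hα hβ)).trans (le_max_left _ _)
  calc ‖((4 * Real.pi ^ 4 : ℝ) : ℂ) * cexp ((Real.pi * I) * (β - α)) * (hermTwoGamma α)⁻¹ * ((Real.pi : ℂ) * Complex.Gamma β ^ 2)⁻¹‖ *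
        ‖etaShift (hermTwo ((2 : ℝ) • d) + t • ((2 : ℂ) • Ξ)) (hermTwo (Real.pi • e)) α β‖
      ≤ max M 0 * (C * Real.exp (-(Real.pi * (e.1 * d.1 + e.2.2 * d.2.2 + 2 * (e.2.1 * conj d.2.1).re))) *
          (Real.pi ^ N * (1 + (e.1 + e.2.2)) ^ N * (1 + (e.1 * e.2.2 - normSq e.2.1) ^ (-N')))) :=
        mul_le_mul hpre hη' (norm_nonneg _) (le_max_right _ _)
    _ = _ := by ring


/-- **CAUCHY ESTIMATE FOR THE `t`-DERIVATIVES** (co-dealer (c)): with `C, N, N′` of `norm_xiShift_param_le₂` and `0 < ρ < r` inside the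
holomorphy disc of ★ (7b), for every `d : ℕ`, `‖t‖`-free:
`‖iteratedDeriv d (t ↦ xiShift (g₀ + t•Ξ) h α β) 0‖ ≤ d! · C e^{−π Re tr(h g₀)} (1 + tr h)^N (1 + det h^{−N′}) ∕ ρ^d`. -/
theorem norm_iteratedDeriv_xiShift_param_le {d : ℝ × ℂ × ℝ} {Ξ : Matrix (Fin 2) (Fin 2) ℂ} {r ρ B : ℝ} (hρ : 0 < ρ) (hρr : ρ < r)
    {h : Matrix (Fin 2) (Fin 2) ℂ} {α β : ℂ}
    (hdiff : DifferentiableOn ℂ (fun t : ℂ => xiShift (hermTwo d + t • Ξ) h α β) (Metric.ball 0 r))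
    (hB : ∀ t : ℂ, ‖t‖ ≤ r → ‖xiShift (hermTwo d + t • Ξ) h α β‖ ≤ B) (n : ℕ) :
    ‖iteratedDeriv n (fun t : ℂ => xiShift (hermTwo d + t • Ξ) h α β) 0‖ ≤ n.factorial * B / ρ ^ n := by
  have hcl : Metric.closedBall (0 : ℂ) ρ ⊆ Metric.ball 0 r := Metric.closedBall_subset_ball hρr
  have hf : DiffContOnCl ℂ (fun t : ℂ => xiShift (hermTwo d + t • Ξ) h α β) (Metric.ball 0 ρ) := by
    refine ⟨hdiff.mono (Metric.ball_subset_ball hρr.le), ?_⟩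
    rw [closure_ball (0 : ℂ) hρ.ne']
    exact hdiff.continuousOn.mono hcl
  refine Complex.norm_iteratedDeriv_le_of_forall_mem_sphere_norm_le n hρ hf fun z hz => hB z ?_
  have : ‖z‖ = ρ := by simpa using hz
  linarith

end Summit.HodgeConjecture.HodgeConjecture.Cruxes.HLiu418.K2LiuHermTwoXiShiftParamGrowth

end
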